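import Summits.QuantumFields.GaugeBoot.BootstrapLinkReversal
import HarnessLib

/-!
# The covariance group of a finite lattice bootstrap: averaging over ALL action-preserving link-reversing relabellings costs at most two levels (gauge-boot, L1/L4 supplement)

HONEST FRAMING (cell `pub-gaugeboot`, page 1 of every file): the venture produces certified bounds
on lattice expectations at stated coupling, gauge group, dimension and torus size; NOT a mass gap,
NOT a continuum limit, NOT a string tension; NOT Yang–Mills-summit-bearing (barriers
`FixedCouplingUltralocality`, `PerturbativeInvisibility`). Structural; it certifies no number.

## Content (any FINITE lattice `ι`, `SU(N)`, polynomial local actions, any real `β`)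

`BootstrapLinkReversal` treats one link-reversing relabelling `revRelabelCM θ rev`. These maps are
closed under composition (`revMap_compPair`: `Θ_{θ₁,rev₁} ∘ Θ_{θ₂,rev₂} = Θ_{θ₂∘θ₁, rev₁ ⊻ rev₂∘θ₁}`), and
so are the ones under which the local actions are covariant. On a finite lattice the covariant ones
with bijective `θ` form a FINITE GROUP — the COVARIANCE GROUP of the bootstrap (on the torus it
contains every translation, axis permutation and reflection: sequel `BootstrapTorusFullSymmetry`):

* `revMap p` (`p = (θ, rev)`, `θ : ι ≃ ι`, `rev : ι → Bool`), `compPair`, ★ `revMap_compPair`,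
  `revMap_refl`; `covPairs S` (covariance `S_e (Θ U) = S_{θ e} U`), `refl_mem_covPairs`,
  `compPair_mem_covPairs`, `compPair_right_injective`; `CovGroup S` (the subtype; finite, non-empty),
  `exists_equiv_covGroup_comp` (composition with a member permutes the group — the closure property
  of `avgFunctional_comp_eq`);
* ★★★ `exists_covGroupInvariant_feasible_suN` — THE REYNOLDS OPERATOR OF THE WHOLE COVARIANCE GROUP AT
  THE COST OF TWO LEVELS: every level-`(n+2)` feasible functional `φ` has a level-`n` feasible
  functional `ψ` invariant under EVERY action-covariant link-reversing relabelling (on all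
  observables), agreeing with `φ` on every observable invariant under the group. (Each `φ ∘ Θ^*` is
  level-`n` feasible by `IsBootstrapFeasible.comp_revRelabel_of_rightRows` — right rows at level `n` from
  level `n + 2`, `isRightRowsOn_of_isBootstrapFeasible_suN`; average over the finite group.)
* ★★ `comp_revMap_eq_of_actionDetermined` — for a single global action `S_e = S₀` (the torus
  case) every observable which depends on `U` only through `S₀ U` (e.g. the mean plaquette) is
  invariant under the whole covariance group.

What this is NOT: the orientation-preserving part alone is lossless at fixed level
(`BootstrapSymmetryReduction`); whether the two levels are ever needed is not claimed.

References: K. Gatermann, P. A. Parrilo, J. Pure Appl. Algebra 192 (2004) 95, Thm 3.3 (Reynolds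
operator of the symmetry group of an SDP); V. Kazakov, Z. Zheng, arXiv:2203.11360 §3.2–3.3. Folklore.
-/

noncomputable section

open Filter Topology NormedSpace
open Literature.MathematicalPhysics.QuantumFieldTheory (LatticeRep)
open Literature.MathematicalPhysics.QuantumLattice

namespace Summit.QuantumFields.GaugeBoot

/-! ## Pairs `(θ, rev)` and their composition -/

section Pairs

variable {ι : Type*} {G : Type*} [Group G] [TopologicalSpace G] [IsTopologicalGroup G]

/-- **The link-reversing relabelling of a pair** `p = (θ, rev)`: `revRelabelCM θ {rev = true}`.
[folklore] -/
def revMap (p : (ι ≃ ι) × (ι → Bool)) : C(ι → G, ι → G) :=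
  revRelabelCM (G := G) p.1 (fun e => p.2 e = true)

/-- `revMap` evaluated. -/
theorem revMap_apply (p : (ι ≃ ι) × (ι → Bool)) (U : ι → G) (e : ι) :
    revMap (G := G) p U e = if p.2 e = true then (U (p.1 e))⁻¹ else U (p.1 e) := rfl

/-- **Composition of pairs**: `(θ₁, rev₁) * (θ₂, rev₂) = (θ₂ ∘ θ₁, rev₁ ⊻ rev₂ ∘ θ₁)`. [folklore] -/
def compPair (p q : (ι ≃ ι) × (ι → Bool)) : (ι ≃ ι) × (ι → Bool) :=
  (p.1.trans q.1, fun e => xor (p.2 e) (q.2 (p.1 e)))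

omit [Group G] [TopologicalSpace G] [IsTopologicalGroup G] in
/-- `compPair` on the link map. -/
@[simp] theorem compPair_fst (p q : (ι ≃ ι) × (ι → Bool)) : (compPair p q).1 = p.1.trans q.1 := rfl

omit [Group G] [TopologicalSpace G] [IsTopologicalGroup G] in
/-- `compPair` on the reversal pattern. -/
@[simp] theorem compPair_snd (p q : (ι ≃ ι) × (ι → Bool)) (e : ι) :
    (compPair p q).2 e = xor (p.2 e) (q.2 (p.1 e)) := rfl

/-- ★ **Link-reversing relabellings compose to link-reversing relabellings**:
`revMap (p * q) = revMap p ∘ revMap q` (a doubly reversed link is read forwards). [folklore] -/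
theorem revMap_compPair (p q : (ι ≃ ι) × (ι → Bool)) :
    revMap (G := G) (compPair p q) = (revMap (G := G) p).comp (revMap (G := G) q) := by
  ext U e
  simp only [revMap_apply, compPair_fst, compPair_snd, Equiv.trans_apply, ContinuousMap.comp_apply]
  cases p.2 e <;> cases q.2 (p.1 e) <;> simp

/-- The identity pair. -/
theorem revMap_refl : revMap (G := G) ((Equiv.refl ι, fun _ => false) : (ι ≃ ι) × (ι → Bool)) = ContinuousMap.id _ := by
  ext U e
  simp [revMap_apply]

/-- The plain relabelling by a bijection is the pair with no reversed link. -/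
theorem revMap_of_forall_false (θ : ι ≃ ι) :
    revMap (G := G) ((θ, fun _ => false) : (ι ≃ ι) × (ι → Bool)) = relabelCM (G := G) θ := by
  ext U e
  simp [revMap_apply]

omit [Group G] [TopologicalSpace G] [IsTopologicalGroup G] in
/-- **Left composition is injective** on pairs. -/
theorem compPair_right_injective (δ : (ι ≃ ι) × (ι → Bool)) : Function.Injective (compPair δ) := by
  intro p q h
  have h1 : p.1 = q.1 := by
    have h' := congrArg Prod.fst h
    simp only [compPair_fst] at h'
    ext e
    have := Equiv.congr_fun h' (δ.1.symm e)
    simpa using this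
  refine Prod.ext h1 (funext fun e => ?_)
  have h' := congrFun (congrArg Prod.snd h) (δ.1.symm e)
  simp only [compPair, Equiv.apply_symm_apply] at h'
  cases hδ : δ.2 (δ.1.symm e) <;> cases hp : p.2 e <;> cases hq : q.2 e <;> simp_all

end Pairs

/-! ## The covariance group -/

section Cov

variable {ι : Type*} {G : Type*} [Group G] [TopologicalSpace G] [IsTopologicalGroup G]
  (S : ι → (ι → G) → ℝ)

/-- **The covariant pairs**: `S_e (Θ_p U) = S_{θ_p e} U` for all links and configurations.
[folklore] -/
def covPairs : Set ((ι ≃ ι) × (ι → Bool)) :=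
  {p | ∀ (e : ι) (U : ι → G), S e (revMap (G := G) p U) = S (p.1 e) U}

/-- The identity pair is covariant. -/
theorem refl_mem_covPairs : ((Equiv.refl ι, fun _ => false) : (ι ≃ ι) × (ι → Bool)) ∈ covPairs (G := G) S := by
  intro e U
  rw [revMap_refl, ContinuousMap.id_apply]
  rfl

/-- **Covariant pairs compose to covariant pairs.** -/
theorem compPair_mem_covPairs {p q : (ι ≃ ι) × (ι → Bool)} (hp : p ∈ covPairs (G := G) S)
    (hq : q ∈ covPairs (G := G) S) : compPair p q ∈ covPairs (G := G) S := by
  intro e U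
  rw [revMap_compPair, ContinuousMap.comp_apply, hp, hq]
  rfl

/-- **The covariance group** of the family of local actions `S`: the covariant pairs, as a type.
[folklore] -/
def CovGroup : Type _ := {p : (ι ≃ ι) × (ι → Bool) // p ∈ covPairs (G := G) S}

/-- The covariance group is non-empty (it contains the identity). -/
theorem nonempty_covGroup : Nonempty (CovGroup (G := G) S) := ⟨⟨_, refl_mem_covPairs S⟩⟩

/-- On a finite lattice the covariance group is finite. -/
theorem finite_covGroup [Finite ι] : Finite (CovGroup (G := G) S) := by
  classical
  haveI : Fintype ι := Fintype.ofFinite ι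
  unfold CovGroup
  infer_instance

/-- **The closure property** (`avgFunctional_comp_eq`): composing with a member of the covariance
group permutes the group (finite lattice: left composition is injective, hence bijective). -/
theorem exists_equiv_covGroup_comp [Finite ι] (δ : CovGroup (G := G) S) :
    ∃ g : CovGroup (G := G) S ≃ CovGroup (G := G) S, ∀ γ : CovGroup (G := G) S,
      (revMap (G := G) δ.1).comp (revMap (G := G) γ.1) = revMap (G := G) (g γ).1 := by
  haveI := finite_covGroup (G := G) S
  let f : CovGroup (G := G) S → CovGroup (G := G) S :=
    fun γ => ⟨compPair δ.1 γ.1, compPair_mem_covPairs S δ.2 γ.2⟩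
  have hf : Function.Injective f := fun γ γ' h =>
    Subtype.ext (compPair_right_injective δ.1 (congrArg Subtype.val h))
  refine ⟨Equiv.ofBijective f (Finite.injective_iff_bijective.1 hf), fun γ => ?_⟩
  rw [Equiv.ofBijective_apply]
  exact (revMap_compPair δ.1 γ.1).symm

variable (r : LatticeRep G)

/-- Every `revMap` preserves the word truncation. -/
theorem comp_revMap_mem_wordTruncation (n : ℕ) (p : (ι ≃ ι) × (ι → Bool)) {x : C(ι → G, ℝ)}
    (hx : x ∈ wordTruncation (ι := ι) r n) : x.comp (revMap (G := G) p) ∈ wordTruncation (ι := ι) r n :=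
  comp_revRelabelCM_mem_wordTruncation r _ _ hx

/-- Every `revMap` preserves the polynomial observables. -/
theorem comp_revMap_mem_polyAlgebra (p : (ι ≃ ι) × (ι → Bool)) {x : C(ι → G, ℝ)}
    (hx : x ∈ polyAlgebra (ι := ι) r) : x.comp (revMap (G := G) p) ∈ polyAlgebra (ι := ι) r :=
  comp_revRelabelCM_mem_polyAlgebra r _ _ hx

end Cov

/-! ## `SU(N)` on a finite lattice: the Reynolds operator of the covariance group costs two levels -/

section SuN

variable {ι : Type*} [DecidableEq ι] (N : ℕ)
  {S : ι → (ι → Matrix.specialUnitaryGroup (Fin N) ℂ) → ℝ}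

/-- ★★ A level-`(n+2)` solution composed with a covariant link-reversing relabelling is a level-`n`
solution. -/
theorem isBootstrapFeasible_comp_revMap_suN
    (hS : ∀ i, S i ∈ polyFunctions (ι := ι) (fundamentalLatticeRep N)) {β : ℝ} {n : ℕ}
    {φ : C(ι → Matrix.specialUnitaryGroup (Fin N) ℂ, ℝ) →ₗ[ℝ] ℝ}
    (hφ : IsBootstrapFeasible (fundamentalLatticeRep N) (suExp N) S β
      (wordTruncation (ι := ι) (fundamentalLatticeRep N) (n + 2)) φ)
    {p : (ι ≃ ι) × (ι → Bool)} (hp : p ∈ covPairs (G := Matrix.specialUnitaryGroup (Fin N) ℂ) S) :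
    IsBootstrapFeasible (fundamentalLatticeRep N) (suExp N) S β
      (wordTruncation (ι := ι) (fundamentalLatticeRep N) n)
      (φ ∘ₗ (ContinuousMap.compRightAlgHom ℝ ℝ (revMap (G := Matrix.specialUnitaryGroup (Fin N) ℂ) p)).toLinearMap) :=
  hφ.comp_revRelabel_of_rightRows (fundamentalLatticeRep N) p.1 (fun e => p.2 e = true) p.1.injective hp
    (suExp_add N) (wordTruncation_mono _ (by omega))
    (fun _ hv => comp_revMap_mem_wordTruncation (fundamentalLatticeRep N) n p hv)
    (isRightRowsOn_of_isBootstrapFeasible_suN N hS hφ)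

/-- ★★★ **The Reynolds operator of the whole covariance group at the cost of two levels.** `SU(N)`
on a finite lattice, polynomial local actions, any real `β`: every level-`(n+2)` feasible functional
`φ` has a level-`n` feasible functional `ψ` which is invariant under EVERY action-covariant
link-reversing relabelling (`ψ (x ∘ Θ) = ψ x` for all observables `x`) and agrees with `φ` on every
observable invariant under all of them. [cite: GatermannParrilo2004, Thm 3.3 (group average of a
feasible point)] -/
theorem exists_covGroupInvariant_feasible_suN [Finite ι]
    (hS : ∀ i, S i ∈ polyFunctions (ι := ι) (fundamentalLatticeRep N)) {β : ℝ} {n : ℕ}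
    {φ : C(ι → Matrix.specialUnitaryGroup (Fin N) ℂ, ℝ) →ₗ[ℝ] ℝ}
    (hφ : IsBootstrapFeasible (fundamentalLatticeRep N) (suExp N) S β
      (wordTruncation (ι := ι) (fundamentalLatticeRep N) (n + 2)) φ) :
    ∃ ψ : C(ι → Matrix.specialUnitaryGroup (Fin N) ℂ, ℝ) →ₗ[ℝ] ℝ,
      IsBootstrapFeasible (fundamentalLatticeRep N) (suExp N) S β
        (wordTruncation (ι := ι) (fundamentalLatticeRep N) n) ψ ∧
      (∀ p ∈ covPairs (G := Matrix.specialUnitaryGroup (Fin N) ℂ) S, ∀ x,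
        ψ (x.comp (revMap (G := Matrix.specialUnitaryGroup (Fin N) ℂ) p)) = ψ x) ∧
      ∀ P : C(ι → Matrix.specialUnitaryGroup (Fin N) ℂ, ℝ),
        (∀ p ∈ covPairs (G := Matrix.specialUnitaryGroup (Fin N) ℂ) S,
          P.comp (revMap (G := Matrix.specialUnitaryGroup (Fin N) ℂ) p) = P) → ψ P = φ P := by
  haveI := finite_covGroup (G := Matrix.specialUnitaryGroup (Fin N) ℂ) S
  haveI : Fintype (CovGroup (G := Matrix.specialUnitaryGroup (Fin N) ℂ) S) := Fintype.ofFinite _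
  haveI := nonempty_covGroup (G := Matrix.specialUnitaryGroup (Fin N) ℂ) S
  set R : CovGroup (G := Matrix.specialUnitaryGroup (Fin N) ℂ) S →
      C(ι → Matrix.specialUnitaryGroup (Fin N) ℂ, ι → Matrix.specialUnitaryGroup (Fin N) ℂ) :=
    fun γ => revMap (G := Matrix.specialUnitaryGroup (Fin N) ℂ) γ.1 with hRdef
  have hR : ∀ δ, ∃ g : CovGroup (G := Matrix.specialUnitaryGroup (Fin N) ℂ) S ≃ CovGroup S,
      ∀ γ, (R δ).comp (R γ) = R (g γ) := fun δ => exists_equiv_covGroup_comp S δ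
  refine ⟨avgFunctional R φ, isBootstrapFeasible_avgFunctional (fundamentalLatticeRep N) R
      (fun γ => isBootstrapFeasible_comp_revMap_suN N hS hφ γ.2), fun p hp x => ?_, fun P hP => ?_⟩
  · exact avgFunctional_comp_eq R hR φ ⟨p, hp⟩ x
  · exact avgFunctional_apply_of_invariant R φ fun γ => hP γ.1 γ.2

omit [DecidableEq ι] in
/-- ★★ **An observable determined by the local actions is invariant under the covariance group**
when the family of local actions is constant, `S_e = S₀` (a single global action, as on the torus):
if `P U` depends on `U` only through `S₀ U`, then `P ∘ Θ = P` for every covariant `Θ`. -/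
theorem comp_revMap_eq_of_actionDetermined {S₀ : (ι → Matrix.specialUnitaryGroup (Fin N) ℂ) → ℝ}
    {P : C(ι → Matrix.specialUnitaryGroup (Fin N) ℂ, ℝ)}
    (hP : ∀ U V, S₀ U = S₀ V → P U = P V) {p : (ι ≃ ι) × (ι → Bool)}
    (hp : p ∈ covPairs (G := Matrix.specialUnitaryGroup (Fin N) ℂ) (fun _ : ι => S₀)) [Nonempty ι] :
    P.comp (revMap (G := Matrix.specialUnitaryGroup (Fin N) ℂ) p) = P := by
  ext U
  exact hP _ _ (hp (Classical.arbitrary ι) U)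

end SuN

end Summit.QuantumFields.GaugeBoot

end
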